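import Literature.NumberTheory.NumberFields.NormOneTorusRealApproximation
import HarnessLib

/-!
# Elements of a number field with prescribed signs at the real places (weak approximation at `∞`)

Topic `NumberTheory/NumberFields`; namespace `Literature.NumberTheory.NumberFields`; **THEOREMS ONLY** (no definition, no named fact, no instance, no
notation, no `sorry`).  Road-independent capital for the cell `pub/hodgecm-mathlib` ENGINE T1 (crux H413 = `stmt-HodgeConjecture-24833`), row «T1b-VANISH ∕
occurrence local–global» (F0P3a-p01 (g5)): the global parameter `λ ∈ K⁺` of a `γ`-invariant hermitian form is chosen with PRESCRIBED SIGNS at the real places of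
`K⁺` (the archimedean signature conditions), which is weak approximation at the infinite places — here read off ★ `denseRange_mixedEmbedding`
(Mathlib's mixed embedding `K → ℝ^{r₁} × ℂ^{r₂}` has dense range).  HC_CM is proved only modulo the printed citations until rung 0 closes.

* `exists_forall_mul_embedding_pos` — for every real-valued `s` non-vanishing on the real places there is `x ∈ K` with `s(w) · w(x) > 0` at every real `w`.
* `exists_forall_embedding_pos_iff` — the two-sided form: `w(x) > 0` exactly on a prescribed set `P` of real places, `< 0` on the others.
* `exists_forall_embedding_pos` ∕ `exists_forall_embedding_neg` — totally positive ∕ totally negative elements (sanity corollaries).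

## References
* [PlatonovRapinchuk1994] V. Platonov, A. Rapinchuk, *Algebraic Groups and Number Theory*, Academic Press (1994), §1.2 (weak approximation), §7.1.
* [Neukirch1999] J. Neukirch, *Algebraic Number Theory*, Springer (1999), Ch. II §3 (approximation theorem).
-/

set_option autoImplicit false

noncomputable section

namespace Literature.NumberTheory.NumberFields

open NumberField NumberField.InfinitePlace NumberField.mixedEmbedding

variable (K : Type) [Field K] [NumberField K]

/-- **Prescribed signs at the real places.**  For `s : {w ∣ ∞ real} → ℝ` with `s w ≠ 0` everywhere there is `x ∈ K` with `s(w) · w(x) > 0` for every real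
place `w` (so `w(x)` has the sign of `s(w)`): the set `{(y, z) : ∀ w, s(w) · y_w > 0}` is open and non-empty in `ℝ^{r₁} × ℂ^{r₂}`, and `K` is dense there
(★ `denseRange_mixedEmbedding`). [cite: PlatonovRapinchuk1994, §1.2] [cite: Neukirch1999, Ch. II §3] -/
theorem exists_forall_mul_embedding_pos (s : {w : InfinitePlace K // w.IsReal} → ℝ) (hs : ∀ w, s w ≠ 0) :
    ∃ x : K, ∀ w : {w : InfinitePlace K // w.IsReal}, 0 < s w * embedding_of_isReal w.2 x := by
  classical
  let U : Set (mixedSpace K) := {p | ∀ w, 0 < s w * p.1 w}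
  have hU : IsOpen U := by
    have : U = ⋂ w, {p : mixedSpace K | 0 < s w * p.1 w} := by
      ext p
      simp only [U, Set.mem_setOf_eq, Set.mem_iInter]
    rw [this]
    exact isOpen_iInter_of_finite fun w =>
      isOpen_lt continuous_const (continuous_const.mul ((continuous_apply w).comp continuous_fst))
  have hne : (U : Set (mixedSpace K)).Nonempty := by
    refine ⟨(fun w => s w, fun _ => 0), fun w => ?_⟩
    exact mul_self_pos.mpr (hs w)
  obtain ⟨x, hx⟩ := (denseRange_mixedEmbedding K).exists_mem_open hU hne
  refine ⟨x, fun w => ?_⟩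
  have h := hx w
  rwa [mixedEmbedding_apply_isReal] at h

/-- **Two-sided form**: given a set `P` of real places there is `x ∈ K` with `w(x) > 0` for `w ∈ P` and `w(x) < 0` for the real `w ∉ P`.
[cite: PlatonovRapinchuk1994, §1.2] [cite: Neukirch1999, Ch. II §3] -/
theorem exists_forall_embedding_pos_iff (P : Set {w : InfinitePlace K // w.IsReal}) :
    ∃ x : K, ∀ w : {w : InfinitePlace K // w.IsReal}, (w ∈ P → 0 < embedding_of_isReal w.2 x) ∧ (w ∉ P → embedding_of_isReal w.2 x < 0) := by
  classical
  obtain ⟨x, hx⟩ := exists_forall_mul_embedding_pos K (fun w => if w ∈ P then 1 else -1) fun w => by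
    split_ifs <;> norm_num
  refine ⟨x, fun w => ⟨fun hw => ?_, fun hw => ?_⟩⟩
  · have h := hx w
    rwa [if_pos hw, one_mul] at h
  · have h := hx w
    rw [if_neg hw, neg_one_mul, Left.neg_pos_iff] at h
    exact h

/-- Totally positive elements exist (sanity: `x = 1`; here from the general statement). [cite: Neukirch1999, Ch. II §3] -/
theorem exists_forall_embedding_pos : ∃ x : K, ∀ w : {w : InfinitePlace K // w.IsReal}, 0 < embedding_of_isReal w.2 x := by
  obtain ⟨x, hx⟩ := exists_forall_embedding_pos_iff K Set.univ
  exact ⟨x, fun w => (hx w).1 (Set.mem_univ w)⟩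

/-- Totally negative elements exist. [cite: Neukirch1999, Ch. II §3] -/
theorem exists_forall_embedding_neg : ∃ x : K, ∀ w : {w : InfinitePlace K // w.IsReal}, embedding_of_isReal w.2 x < 0 := by
  obtain ⟨x, hx⟩ := exists_forall_embedding_pos_iff K ∅
  exact ⟨x, fun w => (hx w).2 (Set.notMem_empty w)⟩

end Literature.NumberTheory.NumberFields

end
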